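import Mathlib.RepresentationTheory.Basic
import Mathlib.GroupTheory.Index
import HarnessLib

/-!
# Crux `HLiu418`, line LD1 — ORBIT AVERAGES OVER A FINITE-INDEX STABILISING SUBGROUP ARE FIXED (generic algebra; THEOREMS ONLY)

Cell hodgecm-mathlib, FLOOR 0, programme-6 line LD1 (socket `stub_S1_facts`, #73 E1θhol), LD1-p01 (g2), generic brick F1 of the (Gβ-L) `FiniteLevel`
organ of LD1-plan's (I′) GERM ROAD junction; `--supports stmt-HodgeConjecture-24832`.  Namespace
`Summit.HodgeConjecture.HodgeConjecture.Cruxes.HLiu418.F0LD1OrbitAverageFixed`.  KERNEL ONLY: theorems; no definition, no named fact, no `sorry`,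
no instance, no notation.  Mathlib-level algebra; nothing of [Liu2021] is asserted; HC_CM is proved only modulo the 7 printed citations (2 remaining:
hLiu418 = stmt-HodgeConjecture-24832, h413 = stmt-HodgeConjecture-24833) until rung 0 closes; count-neutral.

THE POINT.  For a linear action `ρ` of a group `Γ` on a module `V`, a subgroup `S ≤ Γ` of finite index and a vector `x` FIXED by `S`, the
orbit sum over coset representatives `Σ_{q ∈ Γ/S} ρ(q̃) x` (`Γ/S` a `Fintype`) does not depend on the representatives and is FIXED by all of `Γ` (left multiplication
permutes `Γ/S`).  This is the algebraic half of «the compact-open average of a smooth vector is a smooth fixed vector» used by the (Gβ-L) brick: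
there `Γ` = a compact open subgroup of `U(V)(𝔸_f)`, `S` = the (open, hence finite-index) stabiliser of a finite test function.

* `apply_out_mk_eq` — `ρ((kS)~) x = ρ(k) x` for `S`-fixed `x`;
* `apply_sum_out_eq_sum_out` — `ρ(γ) (Σ_q ρ(q̃) x) = Σ_q ρ(q̃) x`;
* `apply_orbitAverage_eq` — the same for the normalised average `(1 ∕ [Γ:S]) • Σ_q ρ(q̃) x` (any scalar).

## References
* [BernsteinZelevinsky1976] I. N. Bernstein, A. V. Zelevinsky, Russian Math. Surveys 31 (1976), §2 (smooth vectors, the idempotents `e_K`).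
-/

set_option autoImplicit false
-- the mandated namespace has the single-problem summit's repeated segment (`HodgeConjecture.HodgeConjecture`)
set_option linter.dupNamespace false

namespace Summit.HodgeConjecture.HodgeConjecture.Cruxes.HLiu418.F0LD1OrbitAverageFixed

variable {k : Type*} [CommSemiring k] {Γ : Type*} [Group Γ] {V : Type*} [AddCommMonoid V] [Module k V]
  (ρ : Representation k Γ V) (S : Subgroup Γ)

/-- **Independence of the representative**: if `S` fixes `x`, then `ρ` of the chosen representative of the coset `kS` applied to `x` is `ρ(k) x`.
[cite: BernsteinZelevinsky1976, §2] -/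
theorem apply_out_mk_eq {x : V} (hS : ∀ s ∈ S, ρ s x = x) (g : Γ) :
    ρ (QuotientGroup.mk (s := S) g).out x = ρ g x := by
  have hmem : g⁻¹ * (QuotientGroup.mk (s := S) g).out ∈ S := by
    rw [← QuotientGroup.eq, QuotientGroup.out_eq']
  have h : (QuotientGroup.mk (s := S) g).out = g * (g⁻¹ * (QuotientGroup.mk (s := S) g).out) := (mul_inv_cancel_left g _).symm
  rw [h, map_mul, Module.End.mul_apply, hS _ hmem]

/-- **The orbit sum over coset representatives is `Γ`-fixed**: `ρ(γ) (Σ_{q ∈ Γ/S} ρ(q̃) x) = Σ_{q ∈ Γ/S} ρ(q̃) x` for `S`-fixed `x` and `S` of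
finite index (left multiplication by `γ` permutes `Γ/S`; the representative changes by an element of `S`). [cite: BernsteinZelevinsky1976, §2] -/
theorem apply_sum_out_eq_sum_out [Fintype (Γ ⧸ S)] {x : V} (hS : ∀ s ∈ S, ρ s x = x) (γ : Γ) :
    ρ γ (∑ q : Γ ⧸ S, ρ q.out x) = ∑ q : Γ ⧸ S, ρ q.out x := by
  rw [map_sum]
  -- `ρ γ (ρ q̃ x) = ρ (γ q̃) x = ρ ((γ • q)~) x`
  have hterm : ∀ q : Γ ⧸ S, ρ γ (ρ q.out x) = ρ (γ • q : Γ ⧸ S).out x := fun q => by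
    rw [← Module.End.mul_apply, ← map_mul]
    conv_rhs => rw [← QuotientGroup.out_eq' q, MulAction.Quotient.smul_mk, apply_out_mk_eq ρ S hS]
    rw [smul_eq_mul]
  simp_rw [hterm]
  exact Fintype.sum_equiv (MulAction.toPerm γ) _ _ fun q => rfl

/-- **The normalised orbit average is `Γ`-fixed**: `ρ(γ) (c • Σ_{q ∈ Γ/S} ρ(q̃) x) = c • Σ_{q ∈ Γ/S} ρ(q̃) x` for every scalar `c` (e.g.
`c = 1 ∕ [Γ:S]`). [cite: BernsteinZelevinsky1976, §2] -/
theorem apply_orbitAverage_eq [Fintype (Γ ⧸ S)] {x : V} (hS : ∀ s ∈ S, ρ s x = x) (c : k) (γ : Γ) :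
    ρ γ (c • ∑ q : Γ ⧸ S, ρ q.out x) = c • ∑ q : Γ ⧸ S, ρ q.out x := by
  rw [map_smul, apply_sum_out_eq_sum_out ρ S hS γ]

/-- **A vector in the span of an `S`-stable family of `S`-fixed vectors is `S`-fixed** (linearity; bookkeeping for averaging a linear
combination of orbit points over the common stabiliser). [folklore] -/
theorem forall_apply_eq_self_of_mem_span {ι : Type*} {v : ι → V} {T : Subgroup Γ} (hv : ∀ i, ∀ s ∈ T, ρ s (v i) = v i)
    {y : V} (hy : y ∈ Submodule.span k (Set.range v)) : ∀ s ∈ T, ρ s y = y := by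
  intro s hs
  refine Submodule.span_induction (p := fun y _ => ρ s y = y) ?_ (map_zero _) (fun a b _ _ ha hb => by rw [map_add, ha, hb])
    (fun c a _ ha => by rw [map_smul, ha]) hy
  rintro _ ⟨i, rfl⟩
  exact hv i s hs

end Summit.HodgeConjecture.HodgeConjecture.Cruxes.HLiu418.F0LD1OrbitAverageFixed
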